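import Summits.BirchSwinnertonDyer.BirchSwinnertonDyer.Theorems.Rank1ResidualJetSwapExclusion
import Summits.BirchSwinnertonDyer.BirchSwinnertonDyer.Theorems.ClassRecordThreeEulerHalvesAtThreeWalkSupplyRootTransverse
import Summits.BirchSwinnertonDyer.BirchSwinnertonDyer.Theorems.KatoDescentTamePotSupersingularJetchevIrreducibleStringent
import HarnessLib

/-!
# Crux `JetchevIrreducibleReadingByName` (item 20165, shared K8-t′ / K9, cell `bsd-potss`), registered stub S2′
# `stub_prop52IrredP` (McCallum 1991 Prop. 5.2 in the IRREDUCIBLE reading): PLUMBING for the `λ₀` half of Kolyvagin's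
# prime swap — McCallum Prop. 4.4 as a ROW binder in cast form, and the root class in `H_{𝓕(s)}` on an irreducible row

Seat `bsd-potss-k8t-c4` g12 (prover), `--supports stmt-BirchSwinnertonDyer-20165`, helper; route-free. HONEST
FRAMING: helper theorems only; nothing is booked, no item closes, BSD is proved for no curve by any of this.

WHAT. Cell `bsd-jet` (seat pv-2 g6, `Rank1ResidualJetSwapStep`, p548164) proved the `λ₀` half of McCallum's prime swap
(LMS LN 153, proof of Prop. 5.2, p. 306): for COMPATIBLE data `d ≼ d'` (`n ∣ nℓ'`) and `d'' ≼ d'` (`n'' = nℓ'/ℓ₀ ∣ nℓ'`),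
Prop. 4.4 at `λ'` moves `loc_{λ'} c_{1+u}(P_n) ≠ 0` to `c_{1+u}(P_{nℓ'})`; its root class `y` (exact depth `u` by
MINIMALITY `hmin`; sign `−e₀`; Selmer) is NOT Kummer at `λ'`; the EXCLUSION LEMMA (`JET.Swap.localization_eq_zero_of_strict_of_relaxed`,
p544205, Selmer-structure level, image-free) with the auxiliary class `t` forbids `loc_{λ₀} y = 0`; Prop. 4.4 at `λ₀`
gives `c_{1+u}(P_{n''}) ≠ 0`, i.e. `p^{u+1} ∤ P_{n''}`. That proof is in the SURJECTIVE frame (`p`-adic tower onto,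
Prop. 4.4 as the typed fact `h44`). This file is the same theorem on the rows `E[p]` IRREDUCIBLE, `p ∣ N_E`:
* the image enters pv-2's proof through `Walk.torsionH1OfDvd_rootClass`, `JET.sign_conjAct_kolyvaginClass`,
  `torsionH1OfDvd_pow_injective` and `Walk.rootClass_mem_selmerGroup_selmerF_of_levelUp` — replaced by this seat's
  `…torsionH1OfDvd_rootClass_of_admissible` (§0, = k9-c4 g10's), k9-c4 g9's
  `JetchevIrreducibleReadingSign.sign_conjAct_kolyvaginClass_of_irreducible`, this seat's
  `torsionH1OfDvd_pow_injective_of_irreducible` (`…SwapPrime`) and `rootClass_mem_selmerGroup_selmerF_of_levelUp_of_irreducible`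
  (§1 below: Kummer places by k9-c4's `JetchevIrreducibleStringent.localization_kolyvaginClass_mem_kummerSelmerStructure_of_GZ31_of_irreducible_kolyvagin`,
  [GZ86 III (3.1)] in the Kolyvagin-SCOPED receptacle shape; transverse places by `…_mem_globalTransverse_of_admissible`);
* McCallum Prop. 4.4 is carried as the ROW-LEVEL binder `h47row` = the conclusion shape of k8t-c4's adapters
  `JetchevIrreducibleH63P2.addOrderOf_localization_kolyvaginClass_mul_eq_of_prop47IrredP2` (from the primed (B)-only
  `ℓ ≠ 2`-guarded reading `h47P2`, hence from `GrossLMS1991.prop37_2_frobeniusCongruence` via p541604) resp.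
  `JetchevIrreducibleH63P.…_of_prop47IrredP` (from `h47P`, no guard), with a GUARD PREDICATE `G` on the swapped prime
  (`G := (· ≠ 2)` resp. `G := ⊤`); the two uses are at the fresh prime `ℓ'` (`G ℓ'`) and at `ℓ₀` (`G ℓ₀`).
Everything else (the level-`p` Poitou–Tate package and Weil datum, the transverse family with `h𝒯σ`/`h𝒯sd`/`hloc`/`hdisj`,
the minimality `hmin`, the compatible data triples) is VERBATIM pv-2 and image-free.

References (locators only; no cited FACT is declared): [cite: McCallumLMS1991, §5 Prop. 5.2 and proof (pp. 304–306),
§4 Prop. 4.4] [cite: Jetchev2008, §3.1 item 7, Lemma 5.2, Thm. 5.1, Rem. 6.2] [cite: GrossZagier1986, III (3.1)]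
[cite: GrossLMS1991, §6 Prop. 6.2 (1), §4 Lemma 4.3] [cite: Howard2004HeegnerKolyvagin, Lemma 2.7.3, Thm. 2.1.11].
Design: theorems only; `K : Type`. Axioms: `propext`, `Classical.choice`, `Quot.sound`.
-/

set_option autoImplicit false
-- the Theorems directory repeats the summit name (sibling precedent `KatoDescentPotSupersingularAssembly.lean`)
set_option linter.dupNamespace false

noncomputable section
open scoped Classical Pointwise
open Function NumberField IsDedekindDomain WeierstrassCurve Field
open Literature.NumberTheory.EllipticCurves Literature.NumberTheory.GaloisRepresentations
open Literature.NumberTheory.EllipticCurves.Jetchev2008 Literature.NumberTheory.EllipticCurves.KolyvaginCocycle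
open Literature.NumberTheory.EllipticCurves.ModularForms
open Literature.NumberTheory.GaloisCohomology Literature.NumberTheory.Automorphic
open Literature.NumberTheory.GaloisRepresentations.DiscreteGaloisModule (transverseSubgroup SelmerStructure)
open Summit.BirchSwinnertonDyer.Rank1Residual
open Summit.BirchSwinnertonDyer.Rank1Residual.JET
open Summit.BirchSwinnertonDyer.Rank1Residual.JET.SelmerVocabulary
open Summit.BirchSwinnertonDyer.Rank1Residual.JET.GlobalDuality
open Summit.BirchSwinnertonDyer.Rank1Residual.JET.Swap
open Summit.BirchSwinnertonDyer.Rank1Residual.X11b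
open Summit.BirchSwinnertonDyer.Rank1Residual.X11b.Three
open Summit.BirchSwinnertonDyer.BirchSwinnertonDyer.Theorems
open Summit.BirchSwinnertonDyer.Rank1Residual.X11b.Three.Koly (torsionH1OfDvd_kolyvaginClass_of_zsmul)

namespace Summit.BirchSwinnertonDyer.BirchSwinnertonDyer.Theorems.JetchevIrreducibleSwap

/-! ### §0 The change of level `ι_* c_k(Q) = c_{k+u}(P_s)` and the Kummer / transverse places of the root class, with the
level-`p^{k+u}` admissibility a HYPOTHESIS (image-free; same statements as k9-c4 g10's `JetchevIrreducibleCoreVertex.…_of_admissible`,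
p550369, duplicated in this namespace only to decouple the build order of the two seats' chains) -/

section Root

variable {K : Type} [Field K] [NumberField K] (W : WeierstrassCurve ℚ)
  [NeZero (W.conductorNorm ℤ)]
  {Dt : ModularParametrizationData W (W.conductorNorm ℤ)} {β : ℤ} {ι : K →+* ℂ}

/-- **`ι_* c_k(Q) = c_{k+u}(P_s)` for a `p^u`-th root `Q ∈ E(K[s])` of the derived point, GIVEN the admissibility
of `E(K[s]) ⊆ E(K̄)` for `p^{k+u}`** (image-free form of stepL's `Walk.torsionH1OfDvd_rootClass`: the same McCallum
cocycle, corner-p1's `Koly.torsionH1OfDvd_kolyvaginClass_of_zsmul`). [cite: McCallumLMS1991, §4 Lemma 4.1, (6), Lemma 4.6]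
[cite: GrossLMS1991, §4 (4.4), (4.6)] -/
theorem torsionH1OfDvd_rootClass_of_admissible {p : ℕ} (hp : p.Prime) {s : ℕ}
    (d : KolyvaginHeegnerData Dt β ι s)
    (k u : ℕ) (Q : (W.baseChange (ringClassField K ι s)).toAffine.Point)
    (hAk : IsAdmissible (absoluteGaloisGroup K) d.pointsSubgroup ((p ^ k : ℕ) : ℤ))
    (hQ : d.toGeomPoints Q ∈ invPoints (absoluteGaloisGroup K) d.pointsSubgroup ((p ^ k : ℕ) : ℤ))
    (hQP : ((p ^ u : ℕ) : ℤ) • Q = d.derivedPoint)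
    (hA : IsAdmissible (absoluteGaloisGroup K) d.pointsSubgroup ((p ^ (k + u) : ℕ) : ℤ))
    (hP : d.toGeomPoints d.derivedPoint ∈
      invPoints (absoluteGaloisGroup K) d.pointsSubgroup ((p ^ (k + u) : ℕ) : ℤ)) :
    WeierstrassCurve.torsionH1OfDvd (W.baseChange K)
        (show ((p ^ k : ℕ) : ℤ) ∣ ((p ^ (k + u) : ℕ) : ℤ) by
          exact_mod_cast pow_dvd_pow p (Nat.le_add_right k u))
        (kolyvaginClass (W.baseChange K) ((p ^ k : ℕ) : ℤ)
          ((W.baseChange K).zsmul_geomPoints_surjective_of_charZero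
            (by exact_mod_cast pow_ne_zero k hp.ne_zero)) hAk (d.toGeomPoints Q) hQ) =
      d.kolyvaginClass hp (k + u) := by
  rw [d.kolyvaginClass_of_admissible hp (k + u) hA hP]
  refine torsionH1OfDvd_kolyvaginClass_of_zsmul
    (W.baseChange K) _ (m := ((p ^ u : ℕ) : ℤ)) ?_ _ _ hAk hA hQ ?_ hP
  · push_cast; ring
  · rw [← map_zsmul, hQP]

/-- **The root class `c_k(Q)` is KUMMER wherever `c_{k+u}(P_s)` is, GIVEN the level-`p^{k+u}` admissibility**
(image-free form of stepL's `Walk.localization_rootClass_mem_kummer`: the local Kummer kernel is cartesian under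
`ι_*`, `mem_selmerLocalKer_iff_torsionH1OfDvd_mem`). [cite: McCallumLMS1991, §4 Lemma 4.3, Lemma 4.6]
[cite: SilvermanAEC2009, X.§4 (Remark 4.1.1)] -/
theorem localization_rootClass_mem_kummer_of_admissible {p : ℕ} (hp : p.Prime) {s : ℕ}
    (d : KolyvaginHeegnerData Dt β ι s) (k u : ℕ) (Q : (W.baseChange (ringClassField K ι s)).toAffine.Point)
    (hAk : IsAdmissible (absoluteGaloisGroup K) d.pointsSubgroup ((p ^ k : ℕ) : ℤ))
    (hQ : d.toGeomPoints Q ∈ invPoints (absoluteGaloisGroup K) d.pointsSubgroup ((p ^ k : ℕ) : ℤ))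
    (hQP : ((p ^ u : ℕ) : ℤ) • Q = d.derivedPoint)
    (hA : IsAdmissible (absoluteGaloisGroup K) d.pointsSubgroup ((p ^ (k + u) : ℕ) : ℤ))
    (hP : d.toGeomPoints d.derivedPoint ∈
      invPoints (absoluteGaloisGroup K) d.pointsSubgroup ((p ^ (k + u) : ℕ) : ℤ))
    (v : Place K)
    (hv : galoisCohomology.localization ((W.baseChange K).torsionGaloisModule ((p ^ (k + u) : ℕ) : ℤ)) v 1
        (d.kolyvaginClass hp (k + u)) ∈
      (W.baseChange K).kummerSelmerStructure ((p ^ (k + u) : ℕ) : ℤ) v) :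
    galoisCohomology.localization ((W.baseChange K).torsionGaloisModule ((p ^ k : ℕ) : ℤ)) v 1
        (kolyvaginClass (W.baseChange K) ((p ^ k : ℕ) : ℤ)
          ((W.baseChange K).zsmul_geomPoints_surjective_of_charZero
            (by exact_mod_cast pow_ne_zero k hp.ne_zero)) hAk (d.toGeomPoints Q) hQ) ∈
      (W.baseChange K).kummerSelmerStructure ((p ^ k : ℕ) : ℤ) v := by
  have hdn : ((p ^ k : ℕ) : ℤ) ∣ ((p ^ (k + u) : ℕ) : ℤ) := by
    exact_mod_cast pow_dvd_pow p (Nat.le_add_right k u)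
  have key : WeierstrassCurve.torsionH1OfDvd (W.baseChange K) hdn
      (kolyvaginClass (W.baseChange K) ((p ^ k : ℕ) : ℤ)
        ((W.baseChange K).zsmul_geomPoints_surjective_of_charZero
          (by exact_mod_cast pow_ne_zero k hp.ne_zero)) hAk (d.toGeomPoints Q) hQ) ∈
      selmerLocalKer (W.baseChange K) (Place.Completion v) ((p ^ (k + u) : ℕ) : ℤ) := by
    rw [torsionH1OfDvd_rootClass_of_admissible W hp d k u Q hAk hQ hQP hA hP,
      ← (W.baseChange K).comap_localization_kummerSelmerStructure]
    exact hv
  rw [← AddSubgroup.mem_comap, (W.baseChange K).comap_localization_kummerSelmerStructure]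
  exact (Summit.BirchSwinnertonDyer.BirchSwinnertonDyer.Theorems.mem_selmerLocalKer_iff_torsionH1OfDvd_mem
    (W.baseChange K) (Place.Completion v) hdn _).mpr key

variable [W.IsElliptic] [W.IsGloballyMinimal] {p : ℕ} [Fact p.Prime] {k : ℕ}
  [∀ j : ℕ, NumberField (ringClassField K ι j)]
  {𝒯 : SelmerStructure ((W.baseChange K).torsionGaloisModule ((p ^ k : ℕ) : ℤ))}
  (h𝒯 : ∀ v : HeightOneSpectrum (𝓞 K), 𝒯 (Sum.inr v) =
    ⨅ (ℓ : ℕ) (_ : ℓ.Prime ∧ (ℓ : 𝓞 K) ∈ v.asIdeal),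
      ⨅ (w' : HeightOneSpectrum (𝓞 (ringClassField K ι ℓ)))
        (_ : w'.asIdeal.LiesOver v.asIdeal),
        letI := (adicCompletionOfLiesOver K (ringClassField K ι ℓ) v w').toAlgebra
        transverseSubgroup (GaloisRep.toLocal v ((W.baseChange K).torsionGaloisModule ((p ^ k : ℕ) : ℤ)))
          (w'.adicCompletion (ringClassField K ι ℓ)))

include h𝒯 in
/-- **The ROOT class is transverse at the primes of `s` (level-`k` global intrinsic family) as soon as `c_{k+u}(P_s)`
lies in `transverseKer_{k+u} ℓ` for every `ℓ ∣ s`, GIVEN the level-`p^{k+u}` admissibility** (image-free form of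
stepL's `Walk.localization_rootClass_mem_globalTransverse`: cartesian transverse condition under `ι_*` at the places
over the primes of `s`, whose local Galois groups fix `E[p^{k+u}]`). [cite: Jetchev2008, §3.1 item 7, §3.1.2]
[cite: McCallumLMS1991, §4 Lemma 4.6] [cite: GrossLMS1991, Prop. 9.6] -/
theorem localization_rootClass_mem_globalTransverse_of_admissible (hK : IsImaginaryQuadratic K)
    {s : ℕ} (hs : Squarefree s) {u : ℕ}
    (hsK : ∀ ℓ ∈ s.primeFactors, Zhang2014.IsKolyvaginPrime (W.conductorNorm ℤ) W K p ℓ ∧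
      k + u ≤ Zhang2014.kolyvaginIndex W p ℓ)
    (d : KolyvaginHeegnerData Dt β ι s) (Q : (W.baseChange (ringClassField K ι s)).toAffine.Point)
    (hAk : IsAdmissible (absoluteGaloisGroup K) d.pointsSubgroup ((p ^ k : ℕ) : ℤ))
    (hQ : d.toGeomPoints Q ∈ invPoints (absoluteGaloisGroup K) d.pointsSubgroup ((p ^ k : ℕ) : ℤ))
    (hQP : ((p ^ u : ℕ) : ℤ) • Q = d.derivedPoint)
    (hA : IsAdmissible (absoluteGaloisGroup K) d.pointsSubgroup ((p ^ (k + u) : ℕ) : ℤ))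
    (hP : d.toGeomPoints d.derivedPoint ∈
      invPoints (absoluteGaloisGroup K) d.pointsSubgroup ((p ^ (k + u) : ℕ) : ℤ))
    (htr : ∀ ℓ ∈ s.primeFactors,
      (d.kolyvaginClass (Fact.out : p.Prime) (k + u) :
        galoisCohomology ((W.baseChange K).torsionGaloisModule ((p ^ (k + u) : ℕ) : ℤ)) 1) ∈
        transverseKer W K ι ((p ^ (k + u) : ℕ) : ℤ) ℓ) :
    ∀ v ∈ placesDividing K s,
      galoisCohomology.localization ((W.baseChange K).torsionGaloisModule ((p ^ k : ℕ) : ℤ)) (Sum.inr v) 1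
          (kolyvaginClass (W.baseChange K) ((p ^ k : ℕ) : ℤ)
            ((W.baseChange K).zsmul_geomPoints_surjective_of_charZero
              (by exact_mod_cast pow_ne_zero k (Fact.out : p.Prime).ne_zero)) hAk (d.toGeomPoints Q) hQ) ∈
        𝒯 (Sum.inr v) := by
  have hp : p.Prime := Fact.out
  have hs0 : s ≠ 0 := hs.ne_zero
  -- the global intrinsic family one level up and the transverse membership of `c_{k+u}(P_s)` there
  obtain ⟨𝒯', h𝒯', -⟩ := Walk.exists_globalTransverseFamily W ι ((p ^ (k + u) : ℕ) : ℤ)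
  have hup : ∀ v ∈ placesDividing K s,
      galoisCohomology.localization ((W.baseChange K).torsionGaloisModule ((p ^ (k + u) : ℕ) : ℤ))
          (Sum.inr v) 1 (d.kolyvaginClass hp (k + u)) ∈ 𝒯' (Sum.inr v) :=
    (Walk.globalTransverse_mem_iff h𝒯' hs _).mpr htr
  intro v hv
  -- `v` lies over a prime `ℓ₀ ∣ s`, Kolyvagin of index `≥ k + u`: `Γ_{K_v}` fixes `E[p^{k+u}]`
  obtain ⟨ℓ₀, hℓ₀, hℓ₀v⟩ := (natCast_mem_iff_exists_primeFactor_mem hs0 v).mp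
    ((mem_placesDividing_iff_natCast_mem hs0 v).mp hv)
  have htriv : ∀ (g : absoluteGaloisGroup (v.adicCompletion K))
      (P : geomTorsion (W.baseChange K) ((p ^ (k + u) : ℕ) : ℤ)), resGal (K := K) (v.adicCompletion K) g • P = P :=
    Walk.resGal_adicCompletion_smul_torsion_eq_self W hK (hsK ℓ₀ hℓ₀).1 (hsK ℓ₀ hℓ₀).2 v hℓ₀v
  -- the cartesian property of the transverse condition under `ι_*` (corner-p1)
  have hdn : p ^ k ∣ p ^ (k + u) := pow_dvd_pow p (Nat.le_add_right k u)
  refine (localization_torsionH1OfDvd_mem_globalTransverse_iff W hdn h𝒯 h𝒯' v htriv _).mpr ?_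
  rw [torsionH1OfDvd_rootClass_of_admissible W hp d k u Q hAk hQ hQP hA hP]
  exact hup v hv

end Root

variable {K : Type} [Field K] [NumberField K] (W : WeierstrassCurve ℚ) [W.IsElliptic]
  [W.IsGloballyMinimal] [NeZero (W.conductorNorm ℤ)]

/-! ### §1 Plumbing: the row binder `h47row` in cast form; the root class in `H_{𝓕(s)}` on an irreducible row -/

omit [W.IsElliptic] in
/-- **The row binder `h47row` (McCallum Prop. 4.4, localisation-order form, guard `G`) with the datum of conductor `mℓ`
given at `N = mℓ`** (through the cast `subst`; = pv-2's `Swap.addOrderOf_localization_kolyvaginClass_eq_of_prop44_cast`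
with the typed fact `h44` replaced by the row binder). [cite: McCallumLMS1991, §4 Prop. 4.4 (p. 301)]
[cite: Jetchev2008, Prop. 4.4, Prop. 4.7 (p. 821)] -/
theorem addOrderOf_localization_kolyvaginClass_eq_of_h47row_cast
    (p : ℕ) [Fact p.Prime] (Dt : ModularParametrizationData W (W.conductorNorm ℤ)) (β : ℤ) (ι : K →+* ℂ)
    (G : ℕ → Prop)
    (h47row : ∀ (M : ℕ), 1 ≤ M → ∀ (m l : ℕ), Squarefree (m * l) → l.Prime → G l → ¬ l ∣ m →
      (∀ l' ∈ (m * l).primeFactors, Zhang2014.IsKolyvaginPrime (W.conductorNorm ℤ) W K p l' ∧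
        M ≤ Zhang2014.kolyvaginIndex W p l') →
      ∀ (d : KolyvaginHeegnerData Dt β ι m) (d' : KolyvaginHeegnerData Dt β ι (m * l)),
      (∀ l' ∈ m.primeFactors, ∀ (x : ringClassField K ι m) (x' : ringClassField K ι (m * l)),
        (x : ℂ) = x' → ((d'.σ l' x' : ringClassField K ι (m * l)) : ℂ) = (d.σ l' x : ℂ)) →
      (∀ s ∈ d.S, ∃ s' ∈ d'.S, ∀ (x : ringClassField K ι m) (x' : ringClassField K ι (m * l)),
        (x : ℂ) = x' → ((s' x' : ringClassField K ι (m * l)) : ℂ) = (s x : ℂ)) →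
      (∀ s' ∈ d'.S, ∃ s ∈ d.S, ∀ (x : ringClassField K ι m) (x' : ringClassField K ι (m * l)),
        (x : ℂ) = x' → ((s' x' : ringClassField K ι (m * l)) : ℂ) = (s x : ℂ)) →
      (∀ (x : ringClassField K ι m) (x' : ringClassField K ι (m * l)),
        (x : ℂ) = x' → d'.emb x' = d.emb x) →
      ∀ (v : HeightOneSpectrum (𝓞 K)), (l : 𝓞 K) ∈ v.asIdeal →
      addOrderOf ((galoisCohomology.localization
          ((W.baseChange K).torsionGaloisModule ((p ^ M : ℕ) : ℤ)) (Sum.inr v) 1 :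
            galH1Torsion (W.baseChange K) ((p ^ M : ℕ) : ℤ) →+ _)
          (d'.kolyvaginClass (Fact.out : p.Prime) M)) =
        addOrderOf ((galoisCohomology.localization
          ((W.baseChange K).torsionGaloisModule ((p ^ M : ℕ) : ℤ)) (Sum.inr v) 1 :
            galH1Torsion (W.baseChange K) ((p ^ M : ℕ) : ℤ) →+ _)
          (d.kolyvaginClass (Fact.out : p.Prime) M)))
    (M : ℕ) (hM : 1 ≤ M) {m l N : ℕ} (hN : m * l = N) (hml : Squarefree N) (hl : l.Prime) (hG : G l)
    (hlm : ¬ l ∣ m)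
    (hK' : ∀ l' ∈ N.primeFactors, Zhang2014.IsKolyvaginPrime (W.conductorNorm ℤ) W K p l' ∧
      M ≤ Zhang2014.kolyvaginIndex W p l')
    (d : KolyvaginHeegnerData Dt β ι m) (d' : KolyvaginHeegnerData Dt β ι N)
    (hσ : ∀ l' ∈ m.primeFactors, ∀ (x : ringClassField K ι m) (x' : ringClassField K ι N),
      (x : ℂ) = x' → ((d'.σ l' x' : ringClassField K ι N) : ℂ) = (d.σ l' x : ℂ))
    (hS : ∀ s ∈ d.S, ∃ s' ∈ d'.S, ∀ (x : ringClassField K ι m) (x' : ringClassField K ι N),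
      (x : ℂ) = x' → ((s' x' : ringClassField K ι N) : ℂ) = (s x : ℂ))
    (hS' : ∀ s' ∈ d'.S, ∃ s ∈ d.S, ∀ (x : ringClassField K ι m) (x' : ringClassField K ι N),
      (x : ℂ) = x' → ((s' x' : ringClassField K ι N) : ℂ) = (s x : ℂ))
    (hemb : ∀ (x : ringClassField K ι m) (x' : ringClassField K ι N), (x : ℂ) = x' → d'.emb x' = d.emb x)
    (v : HeightOneSpectrum (𝓞 K)) (hv : (l : 𝓞 K) ∈ v.asIdeal) :
    addOrderOf ((galoisCohomology.localization
        ((W.baseChange K).torsionGaloisModule ((p ^ M : ℕ) : ℤ)) (Sum.inr v) 1 :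
          galH1Torsion (W.baseChange K) ((p ^ M : ℕ) : ℤ) →+ _)
        (d'.kolyvaginClass (Fact.out : p.Prime) M)) =
      addOrderOf ((galoisCohomology.localization
        ((W.baseChange K).torsionGaloisModule ((p ^ M : ℕ) : ℤ)) (Sum.inr v) 1 :
          galH1Torsion (W.baseChange K) ((p ^ M : ℕ) : ℤ) →+ _)
        (d.kolyvaginClass (Fact.out : p.Prime) M)) := by
  subst hN
  exact h47row M hM m l hml hl hG hlm hK' d d' hσ hS hS' hemb v hv

section LevelUp

variable {Dt : ModularParametrizationData W (W.conductorNorm ℤ)} {β : ℤ} {ι : K →+* ℂ}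
  {p : ℕ} [Fact p.Prime] {k : ℕ} [∀ j : ℕ, NumberField (ringClassField K ι j)]
  {𝒯 : SelmerStructure ((W.baseChange K).torsionGaloisModule ((p ^ k : ℕ) : ℤ))}
  (h𝒯 : ∀ v : HeightOneSpectrum (𝓞 K), 𝒯 (Sum.inr v) =
    ⨅ (ℓ : ℕ) (_ : ℓ.Prime ∧ (ℓ : 𝓞 K) ∈ v.asIdeal),
      ⨅ (w' : HeightOneSpectrum (𝓞 (ringClassField K ι ℓ)))
        (_ : w'.asIdeal.LiesOver v.asIdeal),
        letI := (adicCompletionOfLiesOver K (ringClassField K ι ℓ) v w').toAlgebra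
        transverseSubgroup (GaloisRep.toLocal v ((W.baseChange K).torsionGaloisModule ((p ^ k : ℕ) : ℤ)))
          (w'.adicCompletion (ringClassField K ι ℓ)))

include h𝒯 in
/-- **The class of a `p^u`-th root `Q` of `P_s` lies in `H_{𝓕(s)}`, on an IRREDUCIBLE row** (stepL's
`Walk.rootClass_mem_selmerGroup_selmerF_of_levelUp` with the surjective frame replaced): Kummer places — the root class
is Kummer wherever `c_{k+u}(P_s)` is (`…_mem_kummer_of_admissible`), and `c_{k+u}(P_s)` is Kummer off `s` by Gross
Prop. 6.2 (1) modulo [GZ86 III (3.1)] in the Kolyvagin-SCOPED receptacle shape (k9-c4's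
`localization_kolyvaginClass_mem_kummerSelmerStructure_of_GZ31_of_irreducible_kolyvagin`, CM facts by `_holds`); transverse
places — `…_mem_globalTransverse_of_admissible` from `htr` one level up. GIVEN the level-`p^{k+u}` admissibility `hA`
(on the rows: `NoTorsionIrr.isAdmissible_pointsSubgroup_of_hasIrreducibleModPGaloisRep`). [cite: Jetchev2008, §3.1 item 7 (p. 817), Prop. 4.5–4.6]
[cite: GrossLMS1991, §6 Prop. 6.2 (1)] [cite: GrossZagier1986, III (3.1)] [cite: Howard2004HeegnerKolyvagin, Lemma 2.7.3] -/
theorem rootClass_mem_selmerGroup_selmerF_of_levelUp_of_irreducible (hK : IsImaginaryQuadratic K)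
    (hD3 : NumberField.discr K ≠ -3) (hD4 : NumberField.discr K ≠ -4)
    (hH : SatisfiesHeegnerHypothesis (W.conductorNorm ℤ) K) (hp2 : p ≠ 2)
    (hirr : W.HasIrreducibleModPGaloisRep p) (hpN : p ∣ W.conductorNorm ℤ)
    {n' : ℤ} (hcop' : IsCoprime (p : ℤ) n')
    (hGZ : ∀ (m : ℕ), Squarefree m →
      (∀ q ∈ m.primeFactors, Zhang2014.IsKolyvaginPrime (W.conductorNorm ℤ) W K p q) →
      ∀ (dm : KolyvaginHeegnerData Dt β ι m)
      (γ : ringClassField K ι m ≃ₐ[ℚ] ringClassField K ι m), γ ∈ ringClassGal ι m →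
      ∀ v : HeightOneSpectrum (𝓞 K), ¬ (W.baseChange K).HasGoodReductionAt v →
        n' • pointsMap (W.baseChange K) (v.adicCompletion K)
            (dm.toGeomPoints (pointGalHom W (ringClassField K ι m) γ dm.y)) ∈
          E0Receptacle (W.baseChange K) v ∧
        ∀ (ℓ : ℕ), ℓ ∈ m.primeFactors → ∀ (dm' : KolyvaginHeegnerData Dt β ι (m / ℓ))
          (hle : ringClassField K ι (m / ℓ) ≤ ringClassField K ι m),
          n' • pointsMap (W.baseChange K) (v.adicCompletion K)
              (dm.toGeomPoints (pointGalHom W (ringClassField K ι m) γ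
                (WeierstrassCurve.Affine.Point.map (W' := W)
                  ((RingClassField.inclusion ι hle).restrictScalars ℚ) dm'.y))) ∈
            E0Receptacle (W.baseChange K) v)
    {s : ℕ} (hs : Squarefree s) {u : ℕ}
    (hsK : ∀ ℓ ∈ s.primeFactors, Zhang2014.IsKolyvaginPrime (W.conductorNorm ℤ) W K p ℓ ∧
      k + u ≤ Zhang2014.kolyvaginIndex W p ℓ)
    (d : KolyvaginHeegnerData Dt β ι s) (Q : (W.baseChange (ringClassField K ι s)).toAffine.Point)
    (hAk : IsAdmissible (absoluteGaloisGroup K) d.pointsSubgroup ((p ^ k : ℕ) : ℤ))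
    (hQ : d.toGeomPoints Q ∈ invPoints (absoluteGaloisGroup K) d.pointsSubgroup ((p ^ k : ℕ) : ℤ))
    (hQP : ((p ^ u : ℕ) : ℤ) • Q = d.derivedPoint)
    (hA : IsAdmissible (absoluteGaloisGroup K) d.pointsSubgroup ((p ^ (k + u) : ℕ) : ℤ))
    (hP : d.toGeomPoints d.derivedPoint ∈
      invPoints (absoluteGaloisGroup K) d.pointsSubgroup ((p ^ (k + u) : ℕ) : ℤ))
    (htr : ∀ ℓ ∈ s.primeFactors,
      (d.kolyvaginClass (Fact.out : p.Prime) (k + u) :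
        galoisCohomology ((W.baseChange K).torsionGaloisModule ((p ^ (k + u) : ℕ) : ℤ)) 1) ∈
        transverseKer W K ι ((p ^ (k + u) : ℕ) : ℤ) ℓ) :
    (kolyvaginClass (W.baseChange K) ((p ^ k : ℕ) : ℤ)
        ((W.baseChange K).zsmul_geomPoints_surjective_of_charZero
          (by exact_mod_cast pow_ne_zero k (Fact.out : p.Prime).ne_zero)) hAk (d.toGeomPoints Q) hQ) ∈
      (selmerF W ((p ^ k : ℕ) : ℤ) 𝒯 (placesDividing K s)).selmerGroup := by
  have hp : p.Prime := Fact.out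
  have hs0 : s ≠ 0 := hs.ne_zero
  -- Kummer condition at every place not over a prime of `s`, at level `k + u`, then pulled back
  have hKum : ∀ v : Place K, (∀ ℓ ∈ s.primeFactors, ¬ PlaceOver K v ℓ) →
      galoisCohomology.localization ((W.baseChange K).torsionGaloisModule ((p ^ k : ℕ) : ℤ)) v 1
        (kolyvaginClass (W.baseChange K) ((p ^ k : ℕ) : ℤ)
          ((W.baseChange K).zsmul_geomPoints_surjective_of_charZero
            (by exact_mod_cast pow_ne_zero k hp.ne_zero)) hAk (d.toGeomPoints Q) hQ) ∈
        (W.baseChange K).kummerSelmerStructure ((p ^ k : ℕ) : ℤ) v := by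
    intro v hv
    refine localization_rootClass_mem_kummer_of_admissible W hp d k u Q hAk hQ hQP hA hP v ?_
    exact JetchevIrreducibleStringent.localization_kolyvaginClass_mem_kummerSelmerStructure_of_GZ31_of_irreducible_kolyvagin
      (phi_heegnerPointOfConductor_mem_range_map_ringClassField_holds (W.conductorNorm ℤ) W K)
      (exists_generator_ringClassGalOver_holds (K := K)) hK hD3 hD4 hH hp2 hirr hpN Dt β ι hcop' hGZ hs hsK d v hv
  exact (mem_selmerGroup_selmerF_iff W _ 𝒯 hs0 _).mpr
    ⟨hKum, localization_rootClass_mem_globalTransverse_of_admissible W h𝒯 hK hs hsK d Q hAk hQ hQP hA hP htr⟩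

end LevelUp

end Summit.BirchSwinnertonDyer.BirchSwinnertonDyer.Theorems.JetchevIrreducibleSwap

end
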